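import Literature.NumberTheory.DiophantineGeometry.FunctionFieldDivisors
import Literature.NumberTheory.DiophantineGeometry.FunctionFieldDivisorsConstantsProofs
import HarnessLib

/-!
# Places of a field extension `F/K`: multiplicativity of the order `ord_v` — discharged fact

Proof of the named fact `Literature.NumberTheory.DiophantineGeometry.AlgFunctionField.PlaceOver.ord_mul` stated in
`Literature.NumberTheory.DiophantineGeometry.FunctionFieldDivisors` (kept in a sibling file so
that the statement file stays a definitions/named-facts file; the unfolding lemma
`PlaceOver.ord_of_mem` is reused from the sibling `FunctionFieldDivisorsConstantsProofs`):

* `Literature.AlgFunctionField.PlaceOver.ord_mul_holds : ord_mul`, i.e. for every place `v` of `F/K`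
  and all `x, y ∈ F ∖ {0}`, `ord_v (x y) = ord_v x + ord_v y`.

## Source and proof architecture

H. Stichtenoth, *Algebraic Function Fields and Codes*, 2nd ed., GTM 254 (2009), §1.1:

* Def. 1.1.9 (p. 4): a discrete valuation of `F/K` is a map `v : F → ℤ ∪ {∞}` with, among
  others, property (2): `v(xy) = v(x) + v(y)` for all `x, y ∈ F`.
* Def. 1.1.12 (p. 5): for a place `P` with prime element `t`, every `0 ≠ z ∈ F` is uniquely
  `z = tⁿ u` with `u ∈ O_P^×`, `n ∈ ℤ`; `v_P(z) := n`, `v_P(0) := ∞`.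
* Thm. 1.1.13 (a) (pp. 5–6): `v_P` is a discrete valuation of `F/K` ("Obviously `v_P` has the
  properties (1), (2), (4) and (5) of Definition 1.1.9").

(The docstring of the fact quotes the first-edition numbering "I.1.11 (2)"; in the 2009 edition
the same statement is Def. 1.1.9 (2) with Thm. 1.1.13 (a). The statement itself is faithful: the
Lean `ord_v` agrees with `v_P` on `F ∖ {0}`, and the junk value `ord_v 0 = 0` is excluded by the
hypotheses `x ≠ 0`, `y ≠ 0`.)

In Lean, `PlaceOver.ord v x` is defined by cases: `addVal x` (Mathlib's additive valuation
`IsDiscreteValuationRing.addVal : AddValuation O_v ℕ∞`, which is `n` on `u ϖⁿ`) if `x ∈ O_v`,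
and `-addVal x⁻¹` otherwise. The case distinction is removed once and for all by the *fraction
formula* `ord_eq_sub_of_mul_eq`: if `x b = a` with `a, b ∈ O_v ∖ {0}` then
`ord_v x = addVal a - addVal b` (both branches reduce to `addVal_mul` in the DVR `O_v`). Since
`O_v` is a valuation ring, every `x ≠ 0` is such a fraction (`exists_mul_eq_of_ne_zero`, with
`b = 1` or `a = 1`; Stichtenoth Def. 1.1.4: `z ∈ O` or `z⁻¹ ∈ O`), and multiplying fractions
gives `ord_mul_holds` by `addVal_mul` once more — this is Stichtenoth's "obvious" verification of
(2) from `(tⁿ u)(tᵐ u') = tⁿ⁺ᵐ (u u')`.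

## References

* H. Stichtenoth, *Algebraic Function Fields and Codes*, 2nd ed., GTM 254, Springer 2009, §1.1:
  Def. 1.1.4, Thm. 1.1.6 (b), Def. 1.1.9, Def. 1.1.12, Thm. 1.1.13 (a) (pp. 2–6).
-/

noncomputable section

namespace Literature.NumberTheory.DiophantineGeometry.AlgFunctionField.PlaceOver

universe u v

variable {K : Type u} {F : Type v} [Field K] [Field F] [Algebra K F]

open IsDiscreteValuationRing

/-- Unfolding of `ord_v` off the valuation ring: for `x ∉ O_v` (so `x⁻¹ ∈ O_v`),
`ord_v x = -addVal x⁻¹` (Stichtenoth Def. 1.1.12 with Prop. 1.1.5 (b): `z ∉ O ⇒ z⁻¹ ∈ P`, i.e.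
`v_P(z) = -v_P(z⁻¹) < 0`). [cite: Stichtenoth2009, Def. 1.1.12] -/
theorem ord_of_not_mem (v : PlaceOver K F) {x : F} (hx : x ∉ v.toValuationSubring) :
    v.ord x = -((addVal v.toValuationSubring
      ⟨x⁻¹, (v.toValuationSubring.mem_or_inv_mem x).resolve_left hx⟩).toNat : ℤ) := by
  simp only [ord, dif_neg hx]

/-- **Fraction formula for `ord_v`.** If `x ≠ 0` and `x b = a` with `a, b ∈ O_v` both nonzero,
then `ord_v x = addVal a - addVal b`; i.e. `v_P(a/b) = v_P(a) - v_P(b)`, the case-free form of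
Stichtenoth Def. 1.1.12 (an instance of property (2) of Def. 1.1.9 for `v_P`, Thm. 1.1.13 (a)).
Both branches of the definition of `ord` reduce to `addVal_mul` in the DVR `O_v`.
[cite: Stichtenoth2009, Thm. 1.1.13(a)] -/
theorem ord_eq_sub_of_mul_eq (v : PlaceOver K F) {x : F} (hx : x ≠ 0)
    {a b : v.toValuationSubring} (ha : a ≠ 0) (hb : b ≠ 0) (h : x * b = a) :
    v.ord x = ((addVal v.toValuationSubring a).toNat : ℤ)
      - (addVal v.toValuationSubring b).toNat := by
  by_cases hxO : x ∈ v.toValuationSubring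
  · rw [ord_of_mem v hxO]
    have hx' : (⟨x, hxO⟩ : v.toValuationSubring) ≠ 0 := fun h0 ↦ hx (congrArg Subtype.val h0)
    have hxa : (⟨x, hxO⟩ : v.toValuationSubring) * b = a := Subtype.ext h
    rw [← hxa, addVal_mul, ENat.toNat_add (addVal_eq_top_iff.not.2 hx')
      (addVal_eq_top_iff.not.2 hb)]
    push_cast
    ring
  · rw [ord_of_not_mem v hxO]
    have hxi : x⁻¹ ∈ v.toValuationSubring :=
      (v.toValuationSubring.mem_or_inv_mem x).resolve_left hxO
    have hx' : (⟨x⁻¹, hxi⟩ : v.toValuationSubring) ≠ 0 :=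
      fun h0 ↦ inv_ne_zero hx (congrArg Subtype.val h0)
    have hxb : (⟨x⁻¹, hxi⟩ : v.toValuationSubring) * a = b := by
      apply Subtype.ext
      simp only [MulMemClass.coe_mul, ← h]
      rw [← mul_assoc, inv_mul_cancel₀ hx, one_mul]
    rw [← hxb, addVal_mul, ENat.toNat_add (addVal_eq_top_iff.not.2 hx')
      (addVal_eq_top_iff.not.2 ha)]
    push_cast
    ring

/-- Every `x ≠ 0` in `F` is a fraction `a/b` of nonzero elements of the valuation ring `O_v`
(indeed with `b = 1` if `x ∈ O_v` and `a = 1` if `x⁻¹ ∈ O_v`; Stichtenoth Def. 1.1.4 (2):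
`z ∈ O` or `z⁻¹ ∈ O` for every `z ∈ F`). [cite: Stichtenoth2009, Def. 1.1.4] -/
theorem exists_mul_eq_of_ne_zero (v : PlaceOver K F) {x : F} (hx : x ≠ 0) :
    ∃ a b : v.toValuationSubring, a ≠ 0 ∧ b ≠ 0 ∧ x * b = a := by
  rcases v.toValuationSubring.mem_or_inv_mem x with h | h
  · exact ⟨⟨x, h⟩, 1, fun h0 ↦ hx (congrArg Subtype.val h0), one_ne_zero, by simp⟩
  · exact ⟨1, ⟨x⁻¹, h⟩, one_ne_zero, fun h0 ↦ inv_ne_zero hx (congrArg Subtype.val h0),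
      by simp [hx]⟩

/-- **Discharge of `PlaceOver.ord_mul`** (Stichtenoth Thm. 1.1.13 (a) with Def. 1.1.9 (2):
`v_P(xy) = v_P(x) + v_P(y)`; here for `x, y ≠ 0`, the Lean `ord_v` having the junk value `0` at
`0` instead of `∞`; first-edition numbering I.1.11 (2) as quoted in the fact's docstring).
Proof: write `x = a/b`, `y = c/d` with `a, b, c, d ∈ O_v` nonzero (`exists_mul_eq_of_ne_zero`),
so `xy · (bd) = ac`; by the fraction formula `ord_eq_sub_of_mul_eq` and `addVal_mul` in the DVR
`O_v`, `ord_v (xy) = (addVal a + addVal c) - (addVal b + addVal d) = ord_v x + ord_v y`.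
[cite: Stichtenoth2009, Thm. 1.1.13(a) and Def. 1.1.9(2)] -/
theorem ord_mul_holds : ord_mul (K := K) (F := F) := by
  intro v x y hx hy
  obtain ⟨a, b, ha, hb, hab⟩ := v.exists_mul_eq_of_ne_zero hx
  obtain ⟨c, d, hc, hd, hcd⟩ := v.exists_mul_eq_of_ne_zero hy
  have habcd : x * y * ((b * d : v.toValuationSubring) : F) =
      (a * c : v.toValuationSubring) := by
    push_cast
    rw [← hab, ← hcd]
    ring
  rw [v.ord_eq_sub_of_mul_eq hx ha hb hab, v.ord_eq_sub_of_mul_eq hy hc hd hcd,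
    v.ord_eq_sub_of_mul_eq (mul_ne_zero hx hy) (mul_ne_zero ha hc) (mul_ne_zero hb hd) habcd,
    addVal_mul, addVal_mul,
    ENat.toNat_add (addVal_eq_top_iff.not.2 ha) (addVal_eq_top_iff.not.2 hc),
    ENat.toNat_add (addVal_eq_top_iff.not.2 hb) (addVal_eq_top_iff.not.2 hd)]
  push_cast
  ring

end Literature.NumberTheory.DiophantineGeometry.AlgFunctionField.PlaceOver
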